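import Literature.MathematicalPhysics.QuantumFieldTheory.Balaban1983to89.B13EntrywiseBlockWitness

/-!
# `Balaban1983to89.B13EntrywiseBlockRungWitness` — A6 JOINT WITNESS of the ENTRYWISE NODE-A BLOCK **AND** THE REFERENCE-RUNG
# BLOCK of the N10 junction ([Balaban1988RG2Cluster] Lemmas 1–3 at NODE 00's [B13] group ∕ kernel tower of record, forms 32 ∕ 51C)
# AT ONE ADMISSIBLE REFERENCE PACKAGE: the NODE-A letters `(R, ε_P, κ_P, K̄_P, m₀, R_σ, n_B, d_m)` ARE the package's, and the
# package meets `Admissible`, the accretivity radius, the FOUR PERTURBATIVE THRESHOLDS, `PositiveRates`, `η ≤ etaMax`, `α < R₁`,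
# the letter dominations and the round letters `K_G, K_Cs` — chosen BEFORE the torus, in a non-circular order

statement-level bookkeeping over published theorems with citation tags; finite-matrix MODELS on a site torus and one explicit
constants package, kernel-checked; nothing here is a claim about the Yang–Mills mass gap.

Cell `pub-ymgap`, D-0062 Track A (HUMAN RULING D-0149 width push), node N10 = [Balaban1988RG2Cluster] Lemmas 1–3; seat
`pub-ymgap-dag-n10-w2` g0 (width seat 2), successor item (B′) worded by the n10-c lane (bus 2026-08-27T23:1xZ: «(B′) GO AS OFFERED»);
companion of `B13EntrywiseBlockWitness` (p583593, item (B)).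

WHY.  In (B) the rf-side letters of the NODE-A block (`rf.R rf.εP rf.kapP rf.KbarP rf.m₀ rf.Rσ rf.nB`, `cp.κ₁`) were FREE reals.
At the junction (module 32 `…N10AtRecord11B13WalksBlockEntrywise.b13LeafOfRecord_of_located_entrywise` :218–221, :272–275; 51C alike)
they are the fields of ONE reference package `rf : RefPackage` that must ALSO satisfy `hrf : rf.Admissible`, `hR₁ hR₁R` (an
accretivity radius `0 < R₁ < rf.R`), the four perturbative thresholds `hPσ hP₁ hAσ hA₁` (print p. 15: «O(1)e^{−⅓δ₀M} + O(α₀ + α₁)»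
against the reference positivity, as `8K̄_P c_V₀ e^{−ε_P R_σ} ≤ m₀`, `8K̄_P c_V₀ R₁ ≤ m₀R`, `8K̄_A c_V e^{−ε_A R_σ} ≤ m_{A,0}`,
`8K̄_A c_V R₁ ≤ m_{A,0}R`), `hp : PositiveRates`, `hη : rf.η ≤ etaMax`, `hαR : α < R₁`, `hKdim : ν ≤ rf.dm`, the letter dominations
`hεL hκL hKL hεA hκA hKA hmA` and the round letters `hKG hKCs`.  These COUPLE to the NODE-A block: the junction's expansion constant
`K̄_P` (`hKP`) dominates the entry bound `BΔ` of `hEL`, and the accretivity constant obeys `m₀ ≤ M` (`hKacc`, `M` the model's mass);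
so `hP₁` forbids an entry bound growing with the chart radius — (B)'s hopping `u` (bound `R` on the `R`-ball) will not do.  THIS FILE
re-does the NODE-A block with the CHART-NORMALISED, DISTANCE-DAMPED hopping `(e^{−7d₁(x₀,x₁)}∕R)·u` (entry bound `1` on EVERY
`R`-ball) and exhibits ONE explicit package meeting the rung block, the NODE-A block being inhabited AT THAT PACKAGE on every site torus
of dimension `≤ d_m` carrying a `d₁`-collinear triple with gaps `≥ rf.R_σ` (circles of size `≥ 4⌈R_σ⌉` qualify).
ORDER OF CHOICES (no circularity): `d_m`, `κ₁ ≥ 0` (the junction's `cp.κ₁`), `M > 0`, `α ≥ 0` given ⟶ all rates `= 1`,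
`K̄_L = K̄_P = K̄_A := K̄ = 2c₀(1,1)^{4d_m}e^{2κ₁}(M+1)` (the NODE-A expansion constant at entry bound `M + 1`, uniform in `ν ≤ d_m`),
`m₀ = m_{A,0} := M`, `n_B := 1` ⟶ `η := etaMax` of that package (it reads neither `η` nor `R, R_σ, R₁` — `etaMax_nodeAPackage_indep`,
`rfl`) ⟶ `c_V, c_V₀` now fixed ⟶ `R₁ := α + 1`, `T := 8K̄(c_V₀ + c_V)∕M`, `R_σ := T`, `R := T·R₁ + R₁ + 1` (thresholds by `T ≤ e^T`).
* §1 MODELS — `fluctR M R t u := fromBlocks M ((t∕R)·u) 0 M`, `condOpR` (the `hKK` right-hand side VERBATIM at `fluctR`, (B)'s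
  `deco`, `C := 1`), `kbarNodeA`, `nodeAPackage₀` (dummies `η = R = 1`, `R_σ = 0`), `etaNodeA`, `tNodeA` (= `T`), `nodeAPackage`.
* §2 NODE-A letters of `fluctR`: ★ `rawEntryLetters_fluctR` (`RawEntryLetters (fluctR M R e^{−7d₁(x₀,x₁)}) (loc2 x₀ x₁) R 7 (M+1)`),
  `condOpR_apply` (Hadamard form), the four entries (off-diagonal `σ(□₀)·(e^{−7d}∕R)·u∕2`: GENUINE σ- and u-dependence),
  `condOpR_zero_zero = M·1`, ★ `condOpR_accretive` (m₀ = M), `condOpR_eq` (hKK, `rfl`), `fluctR_not_symm`.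
* §3 the package: `nodeAPackage_fields` ∕ `nodeAPackage_cV` ∕ `etaMax_nodeAPackage_indep` (`rfl`), `kbarModel_eq`,
  `kbarModel_le_kbarNodeA` (hKP for EVERY `ν ≤ d_m`, `c₀(1,1) ≥ 1`), `admissible_nodeAPackage₀`, `etaNodeA_pos_le`
  (`0 < η ≤ 1 = κ_A`), `tNodeA_pos`, ★ `admissible_nodeAPackage`, `positiveRates_nodeAPackage`,
  ★ `thresholds_nodeAPackage` (hPσ hP₁ hAσ hA₁, by `T ≤ e^T`).
* §4 ★★ `entrywiseBlockRung_joint_nonvacuous` — the ∃-PACKAGE: `rf = nodeAPackage d_m κ₁ M α`, `R₁ = α + 1`, and, conjunct for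
  conjunct in the junction's binder names, `hrf hR₁ hR₁R hPσ hP₁ hAσ hA₁ hp hη hαR hεL hκL hKL hεA hκA hKA hmA hKG hKCs` ∧ (for EVERY
  site torus `UT Nf` with `hKdim : ν ≤ rf.dm`, every cube index, every `d₁`-collinear triple with gaps `≥ rf.Rσ`) the NODE-A block
  `hKX hEL hfibF hGJ hηΔ hηε hρε hP2 hCle hCsupp hμΔ hμε hμκ hκεΔ hεP hkapP hKP hKK hKacc hKfar hKmult` READ AT `rf`'s fields, plus
  genuineness.
* §5 ★ `tdist1_fin1_of_le` (`d₁(a,b) = b − a` on `ℤ∕nℤ` for `a ≤ b`, `2(b−a) ≤ n` — the general form of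
  `B13NodeTorusWalksRungWitness.tdist1_fin1_zero`), ★ `exists_collinear_triple_circle` (sites `0, k, 2k`, `k = ⌈R_σ⌉`, `n ≥ 4k`),
  ★ `entrywiseBlockRung_joint_nonvacuous_circle` (the closed instance: both blocks inhabited together by actual data).
WHAT THIS DOES NOT DO (HONEST LABEL «NODE-A BLOCK + REFERENCE RUNG JOINTLY»).  NOT in scope, with their own witnesses ∕ owners:
`hαsmall`, `hRσlarge` (print's two exchange thresholds), the (2.24)–(2.26) numerics `hkap'' hk1–hk4 hθ₀le hθR1le hsmallKθ hc0 hcE hαc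
hsmall` (`B13Bound226Numerals`, `B13ChainJointNonvacuity(226)`, `B13NodeTorusWalksRefRungWitness`), `hPa`, `hvol`, the Lemma 1–2 located
inputs, def-B13's `hKA2 hKG2 hKloc`; a single inhabitant of all ≈ 160 binders of form 32 is NOT claimed.  NOTHING of Bałaban's
`C*Δ_k(σ,𝐔,𝐉)C` or of his constants is constructed or asserted; count-neutral Track-A side landing; NOT a discharge of N10; no node
count moves; one finite four-torus programme at fixed ε per run; nothing continuum ∕ ℝ⁴ ∕ OS ∕ mass-gap ∕ Clay.
CITATIONS.  [Balaban1988RG2Cluster] p. 3 (after (1.7)), (1.11) p. 5, (2.5)–(2.7) pp. 12–13, p. 13 («dist(X, Z₀) > ⅔M»), p. 15 («For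
the pair (U, 0) the operators are symmetric»; «The general case is handled by a perturbative argument»), (2.14)–(2.16) pp. 15–16;
[Balaban1985BackgroundPropagators] (3.93) p. 410, Thm 3.10 (3.107)–(3.108) p. 416, Thm 3.12 p. 423; [Balaban1984PropagatorsII] (2.46)
p. 231, Lemma 2.1 (2.61) p. 234.
0 `sorry`; MODEL ∕ bookkeeping `def`s with bodies only (`fluctR`, `condOpR`, `kbarNodeA`, `nodeAPackage₀`, `etaNodeA`, `tNodeA`,
`nodeAPackage`), no instance, no notation, no axiom; standard axioms.
-/

noncomputable section

namespace Literature.MathematicalPhysics.QuantumFieldTheory.Balaban1983to89.B13EntrywiseBlockRungWitness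

open Metric Set Finset
open scoped Matrix
open Literature.MathematicalPhysics.QuantumFieldTheory.Balaban1983to89
open Literature.MathematicalPhysics.QuantumFieldTheory.Balaban1983to89.B9Thm37GlueTorus
  (tdist1 tdist1_nonneg tdist1_comm tdist1_self tdist1_triangle)
open Literature.MathematicalPhysics.QuantumFieldTheory.Balaban1983to89.B4Sect5Torus (ccoord)
open Literature.MathematicalPhysics.QuantumFieldTheory.Balaban1983to89.B4TorusKernel.MultiPeriod (circAbs circAbs_of_centred)
open Literature.MathematicalPhysics.QuantumFieldTheory.Balaban1983to89.TreeLengthTorus (TPt)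
open Literature.MathematicalPhysics.QuantumFieldTheory.Balaban1983to89.B5TorusCover (UT)
open Literature.MathematicalPhysics.QuantumFieldTheory.Balaban1983to89.B13Eq111SDecoupling (sDecorate)
open Literature.MathematicalPhysics.QuantumFieldTheory.Balaban1983to89.B13EntrywiseWalks
  (RawEntryLetters GeodesicDecoration rawEntryTerm geodesicDecoration_oneCube sDecorate_entryTerm_apply
    sDecorate_symmetrize_rawEntryTerm)
open Literature.MathematicalPhysics.QuantumFieldTheory.Balaban1983to89.NodeOLettersOfWalksAcross (WalkPackage)
open Literature.MathematicalPhysics.QuantumFieldTheory.Balaban1983to89.NodeOLettersOfWalksPerturbative (RefPackage)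
open Literature.MathematicalPhysics.QuantumFieldTheory.Balaban1983to89.B13NodeTorusWalksRungWitness (etaMax_pos etaMax_le_kapA)
open Literature.MathematicalPhysics.QuantumFieldTheory.Balaban1983to89.B13EntrywiseBlockWitness
  (loc2 deco kbarModel deco_inl_inr deco_inr_inl deco_inl_inl deco_inr_inr geodesicDecoration_deco one_map_algebraMap
    ne_of_collinear fiber_loc2_le_one abs_one_apply_le one_apply_range far_loc2)

variable {ν : ℕ} {Nf : Fin ν → ℕ} [∀ i, NeZero (Nf i)]
variable {d N' : ℕ}

/-! ## §1. The models and the package -/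

/-- MODEL (not Bałaban's operator).  The CHART-NORMALISED, DAMPED FLUCTUATION MODEL on one bond and its located copy over the
chart `E₃ = ℂ` of radius `R`: `Δ₀(u) = M·1 + (t∕R)·u·E₁₂` — mass `M`, hopping from the bond into the copy ONLY with amplitude
`t∕R` (`t = e^{−7d₁(x₀,x₁)}` below), so that the entry bound on the `R`-ball is `t`, independent of `R`; NOT symmetric.
[cite: Balaban1988RG2Cluster, (2.7) p.13, p.15 (toy model, not the paper's operator); Balaban1985BackgroundPropagators, (3.108) p.416] -/
def fluctR (M R t : ℝ) (u : ℂ) : Matrix (Unit ⊕ Unit) (Unit ⊕ Unit) ℂ :=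
  Matrix.fromBlocks (fun _ _ => (M : ℂ)) (fun _ _ => ((t / R : ℝ) : ℂ) * u) (fun _ _ => 0) (fun _ _ => (M : ℂ))

/-- MODEL.  THE CONDITIONED OPERATOR of the damped model — the right-hand side of the junction's binder `hKK` VERBATIM at
`Δ₀ := fluctR M R t`, `J := deco x₀ x₁ z □₀` (the one-cube geodesic decoration of (B)), `C := 1`.
[cite: Balaban1988RG2Cluster, p.3 (after (1.7)), (2.5) p.12, p.15] -/
def condOpR (x₀ x₁ z : UT Nf) (cube : TPt d N') (M R t : ℝ) (σ : TPt d N' → ℂ) (u : ℂ) :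
    Matrix (Unit ⊕ Unit) (Unit ⊕ Unit) ℂ :=
  ((1 : Matrix (Unit ⊕ Unit) (Unit ⊕ Unit) ℝ).map (algebraMap ℝ ℂ))ᵀ *
    sDecorate (fun ω : ((Unit ⊕ Unit) × (Unit ⊕ Unit)) ⊕ ((Unit ⊕ Unit) × (Unit ⊕ Unit)) =>
        deco x₀ x₁ z cube (Sum.elim id id ω))
      (fun ω u => Sum.elim (fun ω => (1 / 2 : ℂ) • rawEntryTerm (fluctR M R t) ω u)
        (fun ω => (1 / 2 : ℂ) • (rawEntryTerm (fluctR M R t) ω u)ᵀ) ω) σ u *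
    (1 : Matrix (Unit ⊕ Unit) (Unit ⊕ Unit) ℝ).map (algebraMap ℝ ℂ)

/-- MODEL bookkeeping.  THE PACKAGE's EXPANSION CONSTANT `K̄ = 2·(M + 1)·e^{2κ₁}·c₀(1,1)^{4d_m}` — the junction's `hKP` left-hand side
at the NODE-A letters of (B) with entry bound `M + 1`, made uniform in the torus dimension `ν ≤ d_m`.
[cite: Balaban1988RG2Cluster, (1.11) p.5, (2.16) p.16] -/
def kbarNodeA (dm : ℕ) (κ₁ M : ℝ) : ℝ := 2 * (M + 1) * Real.exp (2 * κ₁) * (B6.c0 1 (1 : ℝ) ^ dm) ^ 4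

/-- MODEL bookkeeping.  The package BEFORE the choice of `η, R, R_σ` (dummies `η = R = 1`, `R_σ = 0`): all rates `1`, the three
expansion constants `K̄`, both accretivity constants `M`, one bond per site. [cite: Balaban1988RG2Cluster, p.15, (2.16) p.16] -/
def nodeAPackage₀ (dm : ℕ) (κ₁ M : ℝ) : RefPackage where
  R := 1
  εL := 1
  kapL := 1
  KbarL := kbarNodeA dm κ₁ M
  εP := 1
  kapP := 1
  KbarP := kbarNodeA dm κ₁ M
  m₀ := M
  εA := 1
  kapA := 1
  KbarA := kbarNodeA dm κ₁ M
  mA₀ := M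
  η := 1
  Rσ := 0
  nB := 1
  dm := dm

/-- MODEL bookkeeping.  THE VOLUME RATE `η := etaMax` of the package (`etaMax` reads neither `η` nor `R, R_σ, R₁` — chosen FIRST, then
`c_V := c₀(1,η)^{d_m}`). [cite: Balaban1988RG2Cluster, (2.16) p.16] -/
def etaNodeA (dm : ℕ) (κ₁ M : ℝ) : ℝ := ((nodeAPackage₀ dm κ₁ M).toWalkPackage 1).etaMax

/-- MODEL bookkeeping.  THE THRESHOLD LETTER `T = 8K̄(c_V₀ + c_V)∕M` (both volume constants, `n_B = 1`): `R_σ := T` and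
`R := T·R₁ + R₁ + 1` make the four perturbative thresholds hold. [cite: Balaban1988RG2Cluster, p.15, (2.16) p.16] -/
def tNodeA (dm : ℕ) (κ₁ M : ℝ) : ℝ :=
  8 * kbarNodeA dm κ₁ M *
    (((1 : ℕ) : ℝ) * B6.c0 1 ((1 : ℝ) / 2) ^ dm + ((1 : ℕ) : ℝ) * B6.c0 1 (etaNodeA dm κ₁ M) ^ dm) / M

/-- MODEL bookkeeping.  ★ THE REFERENCE PACKAGE OF THE JOINT WITNESS: `nodeAPackage₀` with `η := etaNodeA`, `R_σ := T`,
`R := T·(α+1) + (α+1) + 1` (accretivity radius `R₁ = α + 1`). [cite: Balaban1988RG2Cluster, p.15, (2.16) p.16] -/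
def nodeAPackage (dm : ℕ) (κ₁ M α : ℝ) : RefPackage :=
  { nodeAPackage₀ dm κ₁ M with
    R := tNodeA dm κ₁ M * (α + 1) + (α + 1) + 1
    η := etaNodeA dm κ₁ M
    Rσ := tNodeA dm κ₁ M }

/-! ## §2. The NODE-A letters of the damped model -/

section FluctR

variable (M R t : ℝ)

/-- The bond–bond entry is the mass. [cite: Balaban1988RG2Cluster, (2.7) p.13 (toy model)] -/
@[simp] theorem fluctR_inl_inl (u : ℂ) (a b : Unit) : fluctR M R t u (Sum.inl a) (Sum.inl b) = (M : ℂ) := by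
  simp [fluctR]

/-- The copy–copy entry is the mass. [cite: Balaban1988RG2Cluster, (2.7) p.13 (toy model)] -/
@[simp] theorem fluctR_inr_inr (u : ℂ) (a b : Unit) : fluctR M R t u (Sum.inr a) (Sum.inr b) = (M : ℂ) := by
  simp [fluctR]

/-- The bond–copy entry is the damped, chart-normalised configuration `(t∕R)·u`. [cite: Balaban1988RG2Cluster, (2.7) p.13 (toy model)] -/
@[simp] theorem fluctR_inl_inr (u : ℂ) (a b : Unit) :
    fluctR M R t u (Sum.inl a) (Sum.inr b) = ((t / R : ℝ) : ℂ) * u := by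
  simp [fluctR]

/-- The copy–bond entry vanishes. [cite: Balaban1988RG2Cluster, (2.7) p.13 (toy model)] -/
@[simp] theorem fluctR_inr_inl (u : ℂ) (a b : Unit) : fluctR M R t u (Sum.inr a) (Sum.inl b) = 0 := by
  simp [fluctR]

variable {M R t}

/-- **GENUINENESS — the damped model is NOT symmetric** off `u = 0` (`t, R > 0`). [cite: Balaban1988RG2Cluster, p.15] -/
theorem fluctR_not_symm (hR : 0 < R) (ht : 0 < t) {u : ℂ} (hu : u ≠ 0) :
    fluctR M R t u (Sum.inl ()) (Sum.inr ()) ≠ fluctR M R t u (Sum.inr ()) (Sum.inl ()) := by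
  rw [fluctR_inl_inr, fluctR_inr_inl]
  have htr : ((t / R : ℝ) : ℂ) ≠ 0 := Complex.ofReal_ne_zero.2 (div_pos ht hR).ne'
  exact mul_ne_zero htr hu

/-- Entrywise holomorphy of the damped model (entries constant or linear). [cite: Balaban1985BackgroundPropagators, Thm 3.10 p.416] -/
theorem differentiableOn_fluctR (M R t : ℝ) (s : Set ℂ) (i j : Unit ⊕ Unit) :
    DifferentiableOn ℂ (fun u => fluctR M R t u i j) s := by
  rcases i with ⟨⟨⟩⟩ | ⟨⟨⟩⟩ <;> rcases j with ⟨⟨⟩⟩ | ⟨⟨⟩⟩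
  · simp only [fluctR_inl_inl]; exact differentiableOn_const _
  · simp only [fluctR_inl_inr]; exact (differentiableOn_const _).mul differentiableOn_id
  · simp only [fluctR_inr_inl]; exact differentiableOn_const _
  · simp only [fluctR_inr_inr]; exact differentiableOn_const _

/-- ★ **hEL AT THE PACKAGE's RADIUS — THE TWO ENTRYWISE LETTERS OF THE DAMPED MODEL ON THE `R`-BALL with the R-INDEPENDENT
constant `M + 1`** at rate `7`, amplitude `t = e^{−7d₁(x₀,x₁)}` (`M ≥ 0`, `R > 0`): diagonal `M ≤ M + 1`, hopping
`‖(t∕R)u‖ < t = e^{−7d₁(x₀,x₁)} ≤ (M+1)e^{−7d₁(x₀,x₁)}`.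
[cite: Balaban1985BackgroundPropagators, Thm 3.10 (3.107)–(3.108) p.416; Balaban1988RG2Cluster, (2.5) p.12, p.15] -/
theorem rawEntryLetters_fluctR (hM : 0 ≤ M) (hR : 0 < R) (x₀ x₁ : UT Nf) :
    RawEntryLetters (fluctR M R (Real.exp (-(7 * tdist1 Nf x₀ x₁)))) (loc2 x₀ x₁) R 7 (M + 1) where
  decay u hu i j := by
    have hu' : ‖u‖ < R := mem_ball_zero_iff.1 hu
    have hMn : ‖(M : ℂ)‖ = M := by rw [Complex.norm_real, Real.norm_eq_abs, abs_of_nonneg hM]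
    have he1 : Real.exp (-(7 * tdist1 Nf x₀ x₁)) ≤ 1 := by
      rw [Real.exp_le_one_iff]; have := tdist1_nonneg (N := Nf) x₀ x₁; linarith
    rcases i with ⟨⟨⟩⟩ | ⟨⟨⟩⟩ <;> rcases j with ⟨⟨⟩⟩ | ⟨⟨⟩⟩
    · rw [fluctR_inl_inl, hMn]; simp only [loc2, Sum.elim_inl]; rw [tdist1_self, mul_zero, neg_zero, Real.exp_zero]; linarith
    · rw [fluctR_inl_inr, norm_mul, Complex.norm_real, Real.norm_eq_abs,
        abs_of_nonneg (div_nonneg (Real.exp_nonneg _) hR.le)]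
      simp only [loc2, Sum.elim_inl, Sum.elim_inr]
      have h1 : Real.exp (-(7 * tdist1 Nf x₀ x₁)) / R * ‖u‖ ≤ Real.exp (-(7 * tdist1 Nf x₀ x₁)) := by
        rw [div_mul_eq_mul_div]
        calc Real.exp (-(7 * tdist1 Nf x₀ x₁)) * ‖u‖ / R
            ≤ Real.exp (-(7 * tdist1 Nf x₀ x₁)) * R / R := by gcongr
          _ = Real.exp (-(7 * tdist1 Nf x₀ x₁)) := by field_simp
      have h2 : Real.exp (-(7 * tdist1 Nf x₀ x₁)) ≤ (M + 1) * Real.exp (-(7 * tdist1 Nf x₀ x₁)) := by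
        have := Real.exp_nonneg (-(7 * tdist1 Nf x₀ x₁)); nlinarith
      exact h1.trans h2
    · rw [fluctR_inr_inl, norm_zero]; positivity
    · rw [fluctR_inr_inr, hMn]; simp only [loc2, Sum.elim_inr]; rw [tdist1_self, mul_zero, neg_zero, Real.exp_zero]; linarith
  holo i j := differentiableOn_fluctR M R _ _ i j
  B_nonneg := by linarith

end FluctR

section CondOpR

variable {x₀ x₁ z : UT Nf} (cube : TPt d N') {M R t Rσ : ℝ}

/-- **THE HADAMARD FORM of the damped model's conditioned operator**: `KK(σ,u)_{ab} = (∏_{□ ∈ J(a,b)} σ(□))·½(Δ₀(u)_{ab} + Δ₀(u)_{ba})`.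
[cite: Balaban1988RG2Cluster, p.3 (after (1.7)), p.15] -/
theorem condOpR_apply (x₀ x₁ z : UT Nf) (M R t : ℝ) (σ : TPt d N' → ℂ) (u : ℂ) (a b : Unit ⊕ Unit) :
    condOpR x₀ x₁ z cube M R t σ u a b =
      (∏ k ∈ deco x₀ x₁ z cube (a, b), σ k) * ((fluctR M R t u a b + fluctR M R t u b a) / 2) := by
  have hJ : ∀ i j, deco x₀ x₁ z cube (j, i) = deco (d := d) (N' := N') x₀ x₁ z cube (i, j) :=
    (geodesicDecoration_oneCube (loc2 x₀ x₁) ({z} : Finset (UT Nf)) cube one_pos).symm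
  rw [condOpR, one_map_algebraMap, Matrix.transpose_one, Matrix.one_mul, Matrix.mul_one,
    sDecorate_symmetrize_rawEntryTerm _ hJ, sDecorate_entryTerm_apply]

/-- The bond–bond entry of the conditioned operator is the mass (`z ≠ x₀`). [cite: Balaban1988RG2Cluster, (2.7) p.13] -/
theorem condOpR_inl_inl (hRσ : 0 < Rσ) (h0 : Rσ ≤ tdist1 Nf x₀ z) (σ : TPt d N' → ℂ) (u : ℂ) (a b : Unit) :
    condOpR x₀ x₁ z cube M R t σ u (Sum.inl a) (Sum.inl b) = (M : ℂ) := by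
  rw [condOpR_apply, deco_inl_inl cube hRσ h0, Finset.prod_empty, one_mul, fluctR_inl_inl]
  ring

/-- The copy–copy entry of the conditioned operator is the mass (`z ≠ x₁`). [cite: Balaban1988RG2Cluster, (2.7) p.13] -/
theorem condOpR_inr_inr (hRσ : 0 < Rσ) (h1 : Rσ ≤ tdist1 Nf x₁ z) (σ : TPt d N' → ℂ) (u : ℂ) (a b : Unit) :
    condOpR x₀ x₁ z cube M R t σ u (Sum.inr a) (Sum.inr b) = (M : ℂ) := by
  rw [condOpR_apply, deco_inr_inr cube hRσ h1, Finset.prod_empty, one_mul, fluctR_inr_inr]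
  ring

/-- ★ **GENUINENESS — the bond–copy entry of the conditioned operator is `σ(□₀)·((t∕R)·u)∕2`**: σ-dependent AND u-dependent.
[cite: Balaban1988RG2Cluster, p.3 (after (1.7)), (1.11) p.5, (2.5) p.12] -/
theorem condOpR_inl_inr (hcol : tdist1 Nf x₀ z + tdist1 Nf z x₁ ≤ tdist1 Nf x₀ x₁) (σ : TPt d N' → ℂ) (u : ℂ) (a b : Unit) :
    condOpR x₀ x₁ z cube M R t σ u (Sum.inl a) (Sum.inr b) = σ cube * (((t / R : ℝ) : ℂ) * u / 2) := by
  rw [condOpR_apply, deco_inl_inr cube hcol, Finset.prod_singleton, fluctR_inl_inr, fluctR_inr_inl, add_zero]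

/-- … and the copy–bond entry is the same (the conditioned operator is symmetric although `Δ₀(u)` is not). [cite: Balaban1988RG2Cluster, p.15] -/
theorem condOpR_inr_inl (hcol : tdist1 Nf x₀ z + tdist1 Nf z x₁ ≤ tdist1 Nf x₀ x₁) (σ : TPt d N' → ℂ) (u : ℂ) (a b : Unit) :
    condOpR x₀ x₁ z cube M R t σ u (Sum.inr a) (Sum.inl b) = σ cube * (((t / R : ℝ) : ℂ) * u / 2) := by
  rw [condOpR_apply, deco_inr_inl cube hcol, Finset.prod_singleton, fluctR_inl_inr, fluctR_inr_inl, zero_add]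

/-- **THE REFERENCE POINT**: at `(σ, u) = (0, 0)` the conditioned operator is `M·1`. [cite: Balaban1988RG2Cluster, p.15 («For the pair (U, 0) the operators are symmetric»)] -/
theorem condOpR_zero_zero (hRσ : 0 < Rσ) (h0 : Rσ ≤ tdist1 Nf x₀ z) (h1 : Rσ ≤ tdist1 Nf x₁ z)
    (hcol : tdist1 Nf x₀ z + tdist1 Nf z x₁ ≤ tdist1 Nf x₀ x₁) :
    condOpR x₀ x₁ z cube M R t 0 0 = (M : ℂ) • (1 : Matrix (Unit ⊕ Unit) (Unit ⊕ Unit) ℂ) := by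
  ext a b
  rcases a with ⟨⟨⟩⟩ | ⟨⟨⟩⟩ <;> rcases b with ⟨⟨⟩⟩ | ⟨⟨⟩⟩
  · rw [condOpR_inl_inl cube hRσ h0]; simp
  · rw [condOpR_inl_inr cube hcol]; simp
  · rw [condOpR_inr_inl cube hcol]; simp
  · rw [condOpR_inr_inr cube hRσ h1]; simp

/-- ★ **hKacc AT THE PACKAGE's `m₀ = M`**: `M·Σ‖v_i‖² ≤ Re⟨v, KK(0,0)v⟩`.
[cite: Balaban1988RG2Cluster, p.15; Balaban1985BackgroundPropagators, Thm 3.4 p.400] -/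
theorem condOpR_accretive (hRσ : 0 < Rσ) (h0 : Rσ ≤ tdist1 Nf x₀ z) (h1 : Rσ ≤ tdist1 Nf x₁ z)
    (hcol : tdist1 Nf x₀ z + tdist1 Nf z x₁ ≤ tdist1 Nf x₀ x₁) (v : Unit ⊕ Unit → ℂ) :
    M * ∑ i, ‖v i‖ ^ 2 ≤ (∑ i, star (v i) * (condOpR x₀ x₁ z cube M R t 0 0 *ᵥ v) i).re := by
  rw [condOpR_zero_zero cube hRσ h0 h1 hcol]
  have hterm : ∀ i, star (v i) * ((M : ℂ) * v i) = (M : ℂ) * ((‖v i‖ : ℂ) ^ 2) := by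
    intro i
    rw [mul_left_comm, Complex.star_def, Complex.conj_mul']
  have hsum : (∑ i, star (v i) * ((((M : ℂ)) • (1 : Matrix (Unit ⊕ Unit) (Unit ⊕ Unit) ℂ)) *ᵥ v) i) =
      (M : ℂ) * ∑ i, ((‖v i‖ : ℂ) ^ 2) := by
    simp only [Matrix.smul_mulVec, Matrix.one_mulVec, Pi.smul_apply, smul_eq_mul, hterm, Finset.mul_sum]
  rw [hsum]
  have hc : (∑ i, ((‖v i‖ : ℂ) ^ 2)) = ((∑ i, ‖v i‖ ^ 2 : ℝ) : ℂ) := by push_cast; rfl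
  rw [hc, Complex.re_mul_ofReal, Complex.ofReal_re]

/-- hKK — the damped model's conditioned operator IS the junction's right-hand side at `C := 1` (by definition).
[cite: Balaban1988RG2Cluster, p.3 (after (1.7)), (2.5) p.12] -/
theorem condOpR_eq (x₀ x₁ z : UT Nf) (M R t : ℝ) (σ : TPt d N' → ℂ) (u : ℂ) :
    condOpR x₀ x₁ z cube M R t σ u =
      (((1 : Matrix (Unit ⊕ Unit) (Unit ⊕ Unit) ℝ)).map (algebraMap ℝ ℂ))ᵀ *
        sDecorate (fun ω : ((Unit ⊕ Unit) × (Unit ⊕ Unit)) ⊕ ((Unit ⊕ Unit) × (Unit ⊕ Unit)) =>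
            deco x₀ x₁ z cube (Sum.elim id id ω))
          (fun ω u => Sum.elim (fun ω => (1 / 2 : ℂ) • rawEntryTerm (fluctR M R t) ω u)
            (fun ω => (1 / 2 : ℂ) • (rawEntryTerm (fluctR M R t) ω u)ᵀ) ω) σ u *
        (1 : Matrix (Unit ⊕ Unit) (Unit ⊕ Unit) ℝ).map (algebraMap ℝ ℂ) := rfl

end CondOpR

/-! ## §3. The package: fields, admissibility, `η ≤ etaMax`, the four perturbative thresholds, the expansion constant -/

section Package

variable (dm : ℕ) (κ₁ M α : ℝ)

/-- Field bookkeeping (`rfl`). [cite: Balaban1988RG2Cluster, (2.16) p.16] -/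
theorem nodeAPackage_fields :
    (nodeAPackage dm κ₁ M α).R = tNodeA dm κ₁ M * (α + 1) + (α + 1) + 1 ∧
      (nodeAPackage dm κ₁ M α).εL = 1 ∧ (nodeAPackage dm κ₁ M α).kapL = 1 ∧
      (nodeAPackage dm κ₁ M α).KbarL = kbarNodeA dm κ₁ M ∧ (nodeAPackage dm κ₁ M α).εP = 1 ∧
      (nodeAPackage dm κ₁ M α).kapP = 1 ∧ (nodeAPackage dm κ₁ M α).KbarP = kbarNodeA dm κ₁ M ∧
      (nodeAPackage dm κ₁ M α).m₀ = M ∧ (nodeAPackage dm κ₁ M α).εA = 1 ∧ (nodeAPackage dm κ₁ M α).kapA = 1 ∧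
      (nodeAPackage dm κ₁ M α).KbarA = kbarNodeA dm κ₁ M ∧ (nodeAPackage dm κ₁ M α).mA₀ = M ∧
      (nodeAPackage dm κ₁ M α).η = etaNodeA dm κ₁ M ∧ (nodeAPackage dm κ₁ M α).Rσ = tNodeA dm κ₁ M ∧
      (nodeAPackage dm κ₁ M α).nB = 1 ∧ (nodeAPackage dm κ₁ M α).dm = dm :=
  ⟨rfl, rfl, rfl, rfl, rfl, rfl, rfl, rfl, rfl, rfl, rfl, rfl, rfl, rfl, rfl, rfl⟩

/-- The package's volume constants: `c_V₀ = 1·c₀(1,½)^{d_m}`, `c_V = 1·c₀(1,η)^{d_m}` (`rfl`). [cite: Balaban1984PropagatorsII, Lemma 2.1 (2.61) p.234] -/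
theorem nodeAPackage_cV :
    (nodeAPackage dm κ₁ M α).cV₀ = ((1 : ℕ) : ℝ) * B6.c0 1 ((1 : ℝ) / 2) ^ dm ∧
      (nodeAPackage dm κ₁ M α).cV = ((1 : ℕ) : ℝ) * B6.c0 1 (etaNodeA dm κ₁ M) ^ dm :=
  ⟨rfl, rfl⟩

/-- **`etaMax` OF THE PACKAGE DOES NOT READ `η, R, R_σ, R₁`** (`rfl`): it equals `etaNodeA`, the value installed as `η` — the
ORDER OF CHOICES of `WalkPackage.etaMax` («choose `η ≤ etaMax` FIRST»). [cite: Balaban1988RG2Cluster, (2.16) p.16] -/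
theorem etaMax_nodeAPackage_indep (R₁ : ℝ) :
    ((nodeAPackage dm κ₁ M α).toWalkPackage R₁).etaMax = etaNodeA dm κ₁ M := rfl

/-- `c₀(1,1) ≥ 1`, hence `K̄ ≥ 0` and indeed `K̄ ≥ 2(M+1)e^{2κ₁}`. [cite: Balaban1984PropagatorsII, Lemma 2.1 (2.61) p.234] -/
theorem kbarNodeA_nonneg (hM : 0 ≤ M) : 0 ≤ kbarNodeA dm κ₁ M := by
  have hc : 0 ≤ B6.c0 1 (1 : ℝ) := B6RandomWalk.c0_nonneg 1 1
  unfold kbarNodeA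
  positivity

/-- `K̄ > 0` for `M ≥ 0`. [cite: Balaban1984PropagatorsII, Lemma 2.1 (2.61) p.234] -/
theorem kbarNodeA_pos (hM : 0 ≤ M) : 0 < kbarNodeA dm κ₁ M := by
  have hc : 1 ≤ B6.c0 1 (1 : ℝ) := B6Lemma21Arith.one_le_c0 (by norm_num)
  have hc' : 0 < (B6.c0 1 (1 : ℝ) ^ dm) ^ 4 := by positivity
  unfold kbarNodeA
  positivity

variable {dm κ₁ M α}

/-- (B)'s `hKP` left-hand side in closed form: `kbarModel ν κ₁ B = 2B·e^{2κ₁}·c₀(1,1)^{4ν}`. [cite: Balaban1988RG2Cluster, (2.16) p.16] -/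
theorem kbarModel_eq (ν : ℕ) (κ₁ B : ℝ) : kbarModel ν κ₁ B = 2 * B * Real.exp (2 * κ₁) * (B6.c0 1 (1 : ℝ) ^ ν) ^ 4 := by
  unfold kbarModel
  simp only [Nat.cast_one, one_mul, Nat.cast_ofNat, mul_zero, Real.exp_zero, mul_one]
  ring

/-- ★ **hKP FOR EVERY TORUS DIMENSION `ν ≤ d_m`**: the junction's expansion constant at the NODE-A letters (entry bound `M + 1`)
is at most the package's `K̄_P = K̄` (`c₀(1,1) ≥ 1`). [cite: Balaban1988RG2Cluster, (1.11) p.5, (2.16) p.16; Balaban1984PropagatorsII, (2.61) p.234] -/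
theorem kbarModel_le_kbarNodeA (hM : 0 ≤ M) (hν : ν ≤ dm) : kbarModel ν κ₁ (M + 1) ≤ kbarNodeA dm κ₁ M := by
  rw [kbarModel_eq]
  unfold kbarNodeA
  have hc : 1 ≤ B6.c0 1 (1 : ℝ) := B6Lemma21Arith.one_le_c0 (by norm_num)
  have hpow : B6.c0 1 (1 : ℝ) ^ ν ≤ B6.c0 1 (1 : ℝ) ^ dm := pow_le_pow_right₀ hc hν
  have h0 : 0 ≤ B6.c0 1 (1 : ℝ) ^ ν := pow_nonneg (zero_le_one.trans hc) ν
  have h4 : (B6.c0 1 (1 : ℝ) ^ ν) ^ 4 ≤ (B6.c0 1 (1 : ℝ) ^ dm) ^ 4 := pow_le_pow_left₀ h0 hpow 4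
  have hpre : 0 ≤ 2 * (M + 1) * Real.exp (2 * κ₁) := by positivity
  exact mul_le_mul_of_nonneg_left h4 hpre

/-- The dummy-stage package is admissible (`M > 0`). [cite: Balaban1988RG2Cluster, p.15] -/
theorem admissible_nodeAPackage₀ (hM : 0 < M) : (nodeAPackage₀ dm κ₁ M).Admissible where
  hR := one_pos
  hεL := zero_le_one
  hkapL := zero_le_one
  hKbarL := kbarNodeA_nonneg dm κ₁ M hM.le
  hεP := zero_le_one
  hkapP := one_pos
  hKbarP := kbarNodeA_nonneg dm κ₁ M hM.le
  hm₀ := hM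
  hεA := zero_le_one
  hkapA := one_pos
  hKbarA := kbarNodeA_nonneg dm κ₁ M hM.le
  hmA₀ := hM
  hη := one_pos
  hηA := le_rfl

/-- The dummy-stage W-walks package has positive input rates. [cite: Balaban1988RG2Cluster, (2.16) p.16] -/
theorem positiveRates_nodeAPackage₀ (R₁ : ℝ) : ((nodeAPackage₀ dm κ₁ M).toWalkPackage R₁).PositiveRates :=
  ⟨one_pos, one_pos, one_pos, one_pos, one_pos⟩

/-- `0 < η = etaMax ≤ 1 = κ_A`. [cite: Balaban1988RG2Cluster, (2.16) p.16] -/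
theorem etaNodeA_pos_le (hM : 0 < M) : 0 < etaNodeA dm κ₁ M ∧ etaNodeA dm κ₁ M ≤ 1 := by
  have hq := RefPackage.admissible_toWalkPackage (admissible_nodeAPackage₀ (dm := dm) (κ₁ := κ₁) hM) one_pos
  exact ⟨etaMax_pos hq (positiveRates_nodeAPackage₀ 1), etaMax_le_kapA (positiveRates_nodeAPackage₀ 1)⟩

/-- `T > 0`. [cite: Balaban1988RG2Cluster, p.15] -/
theorem tNodeA_pos (hM : 0 < M) : 0 < tNodeA dm κ₁ M := by
  have hK := kbarNodeA_pos dm κ₁ M hM.le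
  have hc₁ : 1 ≤ B6.c0 1 ((1 : ℝ) / 2) := B6Lemma21Arith.one_le_c0 (by norm_num)
  have hc₂ : 1 ≤ B6.c0 1 (etaNodeA dm κ₁ M) := B6Lemma21Arith.one_le_c0 (by simpa using (etaNodeA_pos_le (dm := dm) (κ₁ := κ₁) hM).1)
  have h1 : 0 < ((1 : ℕ) : ℝ) * B6.c0 1 ((1 : ℝ) / 2) ^ dm := by rw [Nat.cast_one, one_mul]; positivity
  have h2 : 0 < ((1 : ℕ) : ℝ) * B6.c0 1 (etaNodeA dm κ₁ M) ^ dm := by rw [Nat.cast_one, one_mul]; positivity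
  unfold tNodeA
  positivity

/-- ★ **THE PACKAGE IS ADMISSIBLE** (`M > 0`, any `α ≥ 0`). [cite: Balaban1988RG2Cluster, p.15, (2.16) p.16] -/
theorem admissible_nodeAPackage (hM : 0 < M) (hα : 0 ≤ α) : (nodeAPackage dm κ₁ M α).Admissible where
  hR := by
    show 0 < tNodeA dm κ₁ M * (α + 1) + (α + 1) + 1
    have := tNodeA_pos (dm := dm) (κ₁ := κ₁) hM; positivity
  hεL := zero_le_one
  hkapL := zero_le_one
  hKbarL := kbarNodeA_nonneg dm κ₁ M hM.le
  hεP := zero_le_one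
  hkapP := one_pos
  hKbarP := kbarNodeA_nonneg dm κ₁ M hM.le
  hm₀ := hM
  hεA := zero_le_one
  hkapA := one_pos
  hKbarA := kbarNodeA_nonneg dm κ₁ M hM.le
  hmA₀ := hM
  hη := (etaNodeA_pos_le (dm := dm) (κ₁ := κ₁) hM).1
  hηA := (etaNodeA_pos_le (dm := dm) (κ₁ := κ₁) hM).2

/-- hp — positive input rates of the W-walks package on any radius. [cite: Balaban1988RG2Cluster, (2.16) p.16] -/
theorem positiveRates_nodeAPackage (R₁ : ℝ) : ((nodeAPackage dm κ₁ M α).toWalkPackage R₁).PositiveRates :=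
  ⟨one_pos, one_pos, one_pos, one_pos, one_pos⟩

/-- ★ **THE FOUR PERTURBATIVE THRESHOLDS HOLD AT THE PACKAGE** with `R₁ = α + 1`: `hPσ`, `hP₁`, `hAσ`, `hA₁` — by `R_σ = T`,
`R = T·R₁ + R₁ + 1`, `T = 8K̄(c_V₀ + c_V)∕M`, all rates `1`, `K̄_P = K̄_A = K̄`, `m₀ = m_{A,0} = M`.
[cite: Balaban1988RG2Cluster, p.15 («O(1)e^{−⅓δ₀M} + O(α₀ + α₁)»), (2.16) p.16] -/
theorem thresholds_nodeAPackage (hM : 0 < M) (hα : 0 ≤ α) :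
    8 * (nodeAPackage dm κ₁ M α).KbarP * (nodeAPackage dm κ₁ M α).cV₀ *
          Real.exp (-((nodeAPackage dm κ₁ M α).εP * (nodeAPackage dm κ₁ M α).Rσ)) ≤ (nodeAPackage dm κ₁ M α).m₀ ∧
      8 * (nodeAPackage dm κ₁ M α).KbarP * (nodeAPackage dm κ₁ M α).cV₀ * (α + 1) ≤
          (nodeAPackage dm κ₁ M α).m₀ * (nodeAPackage dm κ₁ M α).R ∧
      8 * (nodeAPackage dm κ₁ M α).KbarA * (nodeAPackage dm κ₁ M α).cV *
          Real.exp (-((nodeAPackage dm κ₁ M α).εA * (nodeAPackage dm κ₁ M α).Rσ)) ≤ (nodeAPackage dm κ₁ M α).mA₀ ∧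
      8 * (nodeAPackage dm κ₁ M α).KbarA * (nodeAPackage dm κ₁ M α).cV * (α + 1) ≤
          (nodeAPackage dm κ₁ M α).mA₀ * (nodeAPackage dm κ₁ M α).R := by
  obtain ⟨hR, -, -, -, hεP, -, hKP, hm₀, hεA, -, hKA, hmA, -, hRσ, -, -⟩ := nodeAPackage_fields dm κ₁ M α
  obtain ⟨hcV₀, hcV⟩ := nodeAPackage_cV dm κ₁ M α
  rw [hR, hεP, hKP, hm₀, hεA, hKA, hmA, hRσ, hcV₀, hcV, one_mul]
  set K := kbarNodeA dm κ₁ M with hKdef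
  set c₀ : ℝ := ((1 : ℕ) : ℝ) * B6.c0 1 ((1 : ℝ) / 2) ^ dm with hc₀def
  set c₁ : ℝ := ((1 : ℕ) : ℝ) * B6.c0 1 (etaNodeA dm κ₁ M) ^ dm with hc₁def
  set T := tNodeA dm κ₁ M with hTdef
  have hK0 : 0 ≤ K := kbarNodeA_nonneg dm κ₁ M hM.le
  have hc₀0 : 0 ≤ c₀ := by
    rw [hc₀def, Nat.cast_one, one_mul]; exact pow_nonneg (B6RandomWalk.c0_nonneg 1 _) dm
  have hc₁0 : 0 ≤ c₁ := by
    rw [hc₁def, Nat.cast_one, one_mul]; exact pow_nonneg (B6RandomWalk.c0_nonneg 1 _) dm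
  have hT : T = 8 * K * (c₀ + c₁) / M := rfl
  have hT0 : 0 ≤ T := by rw [hT]; positivity
  have hTM : T * M = 8 * K * (c₀ + c₁) := by rw [hT]; field_simp
  -- `T·e^{−T} ≤ 1` from `T + 1 ≤ e^T` (the tree's `SelbergDecay.mul_exp_neg_le_one`, re-derived inline to keep the imports topical)
  have hexp : T * Real.exp (-T) ≤ 1 := by
    have h1 : T + 1 ≤ Real.exp T := Real.add_one_le_exp T
    have h2 : Real.exp T * Real.exp (-T) = 1 := by rw [← Real.exp_add, add_neg_cancel, Real.exp_zero]
    have h3 : 0 ≤ Real.exp (-T) := Real.exp_nonneg _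
    nlinarith
  have hα1 : 0 < α + 1 := by linarith
  -- the two `σ`-thresholds: `8Kc·e^{−T} ≤ (TM)·e^{−T} ≤ M`
  have hσ : ∀ c : ℝ, 0 ≤ c → c ≤ c₀ + c₁ → 8 * K * c * Real.exp (-T) ≤ M := by
    intro c hc hcle
    have h1 : 8 * K * c ≤ T * M := by rw [hTM]; gcongr
    calc 8 * K * c * Real.exp (-T) ≤ T * M * Real.exp (-T) :=
          mul_le_mul_of_nonneg_right h1 (Real.exp_nonneg _)
      _ = M * (T * Real.exp (-T)) := by ring
      _ ≤ M * 1 := mul_le_mul_of_nonneg_left hexp hM.le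
      _ = M := mul_one M
  -- the two `R₁`-thresholds: `8Kc·R₁ ≤ TM·R₁ ≤ M·R`
  have h1' : ∀ c : ℝ, 0 ≤ c → c ≤ c₀ + c₁ → 8 * K * c * (α + 1) ≤ M * (T * (α + 1) + (α + 1) + 1) := by
    intro c hc hcle
    have h1 : 8 * K * c ≤ T * M := by rw [hTM]; gcongr
    calc 8 * K * c * (α + 1) ≤ T * M * (α + 1) := mul_le_mul_of_nonneg_right h1 hα1.le
      _ = M * (T * (α + 1)) := by ring
      _ ≤ M * (T * (α + 1) + (α + 1) + 1) := by gcongr; linarith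
  exact ⟨hσ c₀ hc₀0 (le_add_of_nonneg_right hc₁0), h1' c₀ hc₀0 (le_add_of_nonneg_right hc₁0),
    hσ c₁ hc₁0 (le_add_of_nonneg_left hc₀0), h1' c₁ hc₁0 (le_add_of_nonneg_left hc₀0)⟩

end Package

/-! ## §4. ★★ The joint witness: NODE-A block AND reference rung at ONE admissible package -/

section Joint

/-- ★★ **THE ENTRYWISE NODE-A BLOCK AND THE REFERENCE-RUNG BLOCK OF THE N10 JUNCTION ARE JOINTLY INHABITED AT ONE ADMISSIBLE
REFERENCE PACKAGE** (A6 witness for forms 32 ∕ 51C, «NODE-A block + reference rung jointly»).  For every dimension bound `d_m`,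
polydisc exponent `κ₁ ≥ 0` (the junction's `cp.κ₁`), mass `M > 0` and configuration size `α ≥ 0`: with `rf := nodeAPackage d_m κ₁ M α`
and `R₁ := α + 1` — `hrf : rf.Admissible`, `hR₁`, `hR₁R`, the four perturbative thresholds `hPσ hP₁ hAσ hA₁`, `hp`, `hη`, `hαR`,
the dominations `hεL hκL hKL hεA hκA hKA hmA`, the round letters `hKG hKCs` (at `K_G := K̄`, `K_Cs := 8∕m_{A,0}`); AND for EVERY site
torus `UT Nf` with `hKdim : ν ≤ rf.dm`, every cube index `□₀` and every `d₁`-collinear triple `x₀ z x₁` with gaps `≥ rf.Rσ` there are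
NODE-A data `locF Δ₀ (ρΔ BΔ εΔ κΔ ηΔ μΔ M₁ rC) (mF c₀) J C KK X locN` meeting `hKX hEL hfibF hGJ hηΔ hηε hρε hP2 hCle hCsupp hμΔ hμε hμκ
hκεΔ hεP hkapP hKP hKK hKacc hKfar hKmult` READ AT `rf.R rf.εP rf.kapP rf.KbarP rf.m₀ rf.Rσ rf.nB` and `κ₁` (binder TEXT of module
32 :218–221, :239–275 with `(Z,t)` dropped), genuinely (a decorated entry; conditioned bond–copy entry `σ(□₀)·(e^{−7d₁(x₀,x₁)}∕rf.R)·u∕2`;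
`Δ₀` not symmetric).  [cite: Balaban1988RG2Cluster, (1.11) p.5, (2.5)–(2.7) pp.12–13, p.15, (2.14)–(2.16) pp.15–16; Balaban1985BackgroundPropagators, (3.93) p.410, Thm 3.10 (3.107)–(3.108) p.416, Thm 3.12 p.423] -/
theorem entrywiseBlockRung_joint_nonvacuous (dm : ℕ) {κ₁ M α : ℝ} (hκ₁ : 0 ≤ κ₁) (hM : 0 < M) (hα : 0 ≤ α) :
    ∃ (rf : RefPackage) (R₁ KG KCs : ℝ), rf = nodeAPackage dm κ₁ M α ∧ R₁ = α + 1 ∧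
      -- hrf hR₁ hR₁R
      rf.Admissible ∧ 0 < R₁ ∧ R₁ < rf.R ∧
      -- hPσ hP₁ hAσ hA₁
      8 * rf.KbarP * rf.cV₀ * Real.exp (-(rf.εP * rf.Rσ)) ≤ rf.m₀ ∧ 8 * rf.KbarP * rf.cV₀ * R₁ ≤ rf.m₀ * rf.R ∧
      8 * rf.KbarA * rf.cV * Real.exp (-(rf.εA * rf.Rσ)) ≤ rf.mA₀ ∧ 8 * rf.KbarA * rf.cV * R₁ ≤ rf.mA₀ * rf.R ∧
      -- hp hη hαR
      (rf.toWalkPackage R₁).PositiveRates ∧ rf.η ≤ (rf.toWalkPackage R₁).etaMax ∧ α < R₁ ∧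
      -- hεL hκL hKL hεA hκA hKA hmA
      rf.εL ≤ rf.εP ∧ rf.kapL ≤ rf.kapP ∧ rf.KbarP ≤ rf.KbarL ∧ rf.εA ≤ rf.εP ∧ rf.kapA ≤ rf.kapP ∧ rf.KbarP ≤ rf.KbarA ∧
        rf.mA₀ ≤ rf.m₀ ∧
      -- hKG hKCs
      (rf.toWalkPackage R₁).Kbar ≤ KG ∧ 8 / rf.mA₀ ≤ KCs ∧
      -- the NODE-A block at this package, on every admissible torus ∕ triple (hKdim is the torus's `ν ≤ rf.dm`)
      (∀ {ν : ℕ} {Nf : Fin ν → ℕ} [∀ i, NeZero (Nf i)] {d N' : ℕ} (cube : TPt d N') {x₀ z x₁ : UT Nf},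
        ν ≤ rf.dm → rf.Rσ ≤ tdist1 Nf x₀ z → rf.Rσ ≤ tdist1 Nf x₁ z →
        tdist1 Nf x₀ z + tdist1 Nf z x₁ ≤ tdist1 Nf x₀ x₁ →
        ∃ (locF : Unit ⊕ Unit → UT Nf) (Δ₀ : ℂ → Matrix (Unit ⊕ Unit) (Unit ⊕ Unit) ℂ)
          (ρΔ BΔ εΔ κΔ ηΔ μΔ M₁ rC : ℝ) (mF c₀ : ℕ)
          (J : (Unit ⊕ Unit) × (Unit ⊕ Unit) → Finset (TPt d N'))
          (C : Matrix (Unit ⊕ Unit) (Unit ⊕ Unit) ℝ)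
          (KK : (TPt d N' → ℂ) → ℂ → Matrix (Unit ⊕ Unit) (Unit ⊕ Unit) ℂ)
          (X : Finset (UT Nf)) (locN : Unit ⊕ Unit → UT Nf),
          -- hKX
          X.Nonempty ∧
          -- hEL
          RawEntryLetters Δ₀ locF rf.R ρΔ BΔ ∧
          -- hfibF
          (∀ y : UT Nf, (Finset.univ.filter fun k => locF k = y).card ≤ mF) ∧
          -- hGJ
          GeodesicDecoration J locF X c₀ M₁ ∧
          -- hηΔ hηε hρε hP2
          0 < ηΔ ∧ ηΔ ≤ εΔ ∧ εΔ < ρΔ ∧ 2 * κ₁ ≤ ηΔ * M₁ ∧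
          -- hCle hCsupp
          (∀ k i, |C k i| ≤ 1) ∧ (∀ k i, C k i ≠ 0 → tdist1 Nf (locF k) (locN i) ≤ rC) ∧
          -- hμΔ hμε hμκ hκεΔ
          0 < μΔ ∧ 2 * μΔ ≤ εΔ - ηΔ ∧ 2 * μΔ ≤ κΔ ∧ κΔ ≤ ρΔ - εΔ ∧
          -- hεP hkapP
          rf.εP ≤ εΔ - ηΔ - μΔ - μΔ ∧ rf.kapP ≤ κΔ - μΔ - μΔ ∧
          -- hKP
          (mF * B6.c0 1 μΔ ^ ν) * ((mF * B6.c0 1 μΔ ^ ν) * Real.exp ((ρΔ - ηΔ) * rC) *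
              (Real.exp (κ₁ * (2 * c₀ : ℕ)) * (BΔ * (mF * mF + 1))) * B6.c0 1 μΔ ^ ν) *
              Real.exp ((ρΔ - ηΔ - μΔ) * rC) * B6.c0 1 μΔ ^ ν ≤ rf.KbarP ∧
          -- hKK
          (∀ σ u, KK σ u =
            ((C.map (algebraMap ℝ ℂ))ᵀ *
              sDecorate (fun ω : ((Unit ⊕ Unit) × (Unit ⊕ Unit)) ⊕ ((Unit ⊕ Unit) × (Unit ⊕ Unit)) =>
                  J (Sum.elim id id ω))
                (fun ω u => Sum.elim (fun ω => (1 / 2 : ℂ) • rawEntryTerm Δ₀ ω u)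
                  (fun ω => (1 / 2 : ℂ) • (rawEntryTerm Δ₀ ω u)ᵀ) ω) σ u *
              C.map (algebraMap ℝ ℂ))) ∧
          -- hKacc
          (∀ v : Unit ⊕ Unit → ℂ, rf.m₀ * ∑ i, ‖v i‖ ^ 2 ≤ (∑ i, star (v i) * (KK 0 0 *ᵥ v) i).re) ∧
          -- hKfar
          (∀ k, ∀ z' ∈ X, rf.Rσ ≤ tdist1 Nf (locN k) z') ∧
          -- hKmult
          (∀ x : UT Nf, (Finset.univ.filter fun k => locN k = x).card ≤ rf.nB) ∧
          -- GENUINENESS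
          (∃ ω, (J ω).Nonempty) ∧
          (∀ σ u, KK σ u (Sum.inl ()) (Sum.inr ()) =
            σ cube * (((Real.exp (-(7 * tdist1 Nf x₀ x₁)) / rf.R : ℝ) : ℂ) * u / 2)) ∧
          (∀ u : ℂ, u ≠ 0 → Δ₀ u (Sum.inl ()) (Sum.inr ()) ≠ Δ₀ u (Sum.inr ()) (Sum.inl ()))) := by
  obtain ⟨hR, hεL, hκL, hKL, hεP, hκP, hKP, hm₀, hεA, hκA, hKA, hmA, hη, hRσ, hnB, hdm⟩ := nodeAPackage_fields dm κ₁ M α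
  have hT := tNodeA_pos (dm := dm) (κ₁ := κ₁) hM
  have hth := thresholds_nodeAPackage (dm := dm) (κ₁ := κ₁) hM hα
  have hrf := admissible_nodeAPackage (dm := dm) (κ₁ := κ₁) hM hα
  refine ⟨nodeAPackage dm κ₁ M α, α + 1, ((nodeAPackage dm κ₁ M α).toWalkPackage (α + 1)).Kbar,
    8 / (nodeAPackage dm κ₁ M α).mA₀, rfl, rfl, hrf, by linarith, ?_, hth.1, hth.2.1, hth.2.2.1, hth.2.2.2,
    positiveRates_nodeAPackage (α + 1), ?_, by linarith, ?_, ?_, ?_, ?_, ?_, ?_, ?_, le_rfl, le_rfl, ?_⟩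
  · rw [hR]; nlinarith
  · rw [etaMax_nodeAPackage_indep, hη]
  · rw [hεL, hεP]
  · rw [hκL, hκP]
  · rw [hKL, hKP]
  · rw [hεA, hεP]
  · rw [hκA, hκP]
  · rw [hKA, hKP]
  · rw [hmA, hm₀]
  -- the NODE-A block at the package
  intro ν Nf _ d N' cube x₀ z x₁ hν h0 h1 hcol
  rw [hdm] at hν
  rw [hRσ] at h0 h1
  have hRpos : 0 < (nodeAPackage dm κ₁ M α).R := hrf.hR
  have hne : x₀ ≠ x₁ := ne_of_collinear hT h0 hcol
  refine ⟨loc2 x₀ x₁, fluctR M (nodeAPackage dm κ₁ M α).R (Real.exp (-(7 * tdist1 Nf x₀ x₁))), 7, M + 1, 4, 3, 1, 1,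
    2 * κ₁ + 1, 0, 1, 1, deco x₀ x₁ z cube, 1, condOpR x₀ x₁ z cube M (nodeAPackage dm κ₁ M α).R
      (Real.exp (-(7 * tdist1 Nf x₀ x₁))), {z}, loc2 x₀ x₁,
    Finset.singleton_nonempty z, rawEntryLetters_fluctR hM.le hRpos x₀ x₁, fun y => fiber_loc2_le_one hne y,
    geodesicDecoration_deco cube x₀ x₁ z (by linarith), one_pos, by norm_num, by norm_num, by nlinarith, abs_one_apply_le,
    fun k i h => one_apply_range k i h, one_pos, by norm_num, by norm_num, by norm_num, ?_, ?_, ?_,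
    fun σ u => condOpR_eq cube x₀ x₁ z M _ _ σ u, ?_, ?_, ?_, ⟨(Sum.inl (), Sum.inr ()), ?_⟩,
    fun σ u => condOpR_inl_inr cube hcol σ u () (), fun u hu => fluctR_not_symm hRpos (Real.exp_pos _) hu⟩
  · rw [hεP]; norm_num
  · rw [hκP]; norm_num
  · -- hKP: the left-hand side is (B)'s `kbarModel ν κ₁ (M+1)` verbatim
    rw [hKP]
    exact (le_of_eq (by unfold kbarModel; rfl)).trans (kbarModel_le_kbarNodeA (κ₁ := κ₁) hM.le hν)
  · intro v; rw [hm₀]; exact condOpR_accretive cube hT h0 h1 hcol v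
  · intro k; rw [hRσ]; exact far_loc2 h0 h1 k
  · intro x; rw [hnB]; exact fiber_loc2_le_one hne x
  · rw [deco_inl_inr cube hcol]; exact Finset.singleton_nonempty _

end Joint

/-! ## §5. Admissible tori exist at every size: the circle `ℤ∕nℤ`, sites `0, k, 2k`, `k = ⌈R_σ⌉`, `n ≥ 4k` -/

section Circle

/-- **`d₁(a, b) = b − a` on the circle `ℤ∕nℤ`** for representatives `a ≤ b` with `2(b − a) ≤ n` — the general form of
`B13NodeTorusWalksRungWitness.tdist1_fin1_zero` (the `j = 0` contour length of (2.46)). [cite: Balaban1984PropagatorsII, (2.46) p.231] -/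
theorem tdist1_fin1_of_le (n : ℕ) [NeZero n] (a b : Fin n) (hab : (a : ℕ) ≤ b) (h2 : 2 * ((b : ℕ) - a) ≤ n) :
    tdist1 (fun _ : Fin 1 => n) (UT.ofSite _ fun _ => a) (UT.ofSite _ fun _ => b) = (((b : ℕ) - a : ℕ) : ℝ) := by
  have hn : 1 ≤ n := Nat.one_le_iff_ne_zero.2 (NeZero.ne n)
  unfold tdist1
  rw [Finset.univ_unique, Finset.sum_singleton, UT.toSite_ofSite, UT.toSite_ofSite]
  unfold ccoord
  have hba : ((b : ℕ) : ℤ) - ((a : ℕ) : ℤ) = (((b : ℕ) - a : ℕ) : ℤ) := by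
    rw [Nat.cast_sub hab]
  have h2' : 2 * |((a : ℕ) : ℤ) - ((b : ℕ) : ℤ)| ≤ (n : ℤ) := by
    rw [abs_sub_comm, hba, Nat.abs_cast]; exact_mod_cast h2
  rw [circAbs_of_centred hn h2', abs_sub_comm, hba, Nat.abs_cast, Int.toNat_natCast]

/-- ★ **A `d₁`-COLLINEAR TRIPLE WITH GAPS `≥ R_σ` EXISTS ON EVERY CIRCLE OF SIZE `n ≥ 4⌈R_σ⌉`** (`R_σ > 0`): the sites `0, k, 2k`,
`k = ⌈R_σ⌉`, have `d₁(0,k) = d₁(k,2k) = k ≥ R_σ`, `d₁(0,2k) = 2k`. [cite: Balaban1984PropagatorsII, (2.46) p.231; Balaban1988RG2Cluster, p.13] -/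
theorem exists_collinear_triple_circle {Rσ : ℝ} (hRσ : 0 < Rσ) (n : ℕ) [NeZero n] (hn : 4 * ⌈Rσ⌉₊ ≤ n) :
    ∃ x₀ z x₁ : UT (fun _ : Fin 1 => n),
      Rσ ≤ tdist1 (fun _ : Fin 1 => n) x₀ z ∧ Rσ ≤ tdist1 (fun _ : Fin 1 => n) x₁ z ∧
        tdist1 (fun _ : Fin 1 => n) x₀ z + tdist1 (fun _ : Fin 1 => n) z x₁ ≤ tdist1 (fun _ : Fin 1 => n) x₀ x₁ := by
  set k : ℕ := ⌈Rσ⌉₊ with hk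
  have hk1 : 1 ≤ k := Nat.one_le_iff_ne_zero.2 (by rw [hk]; exact Nat.ne_of_gt (Nat.ceil_pos.2 hRσ))
  have hkR : Rσ ≤ (k : ℝ) := Nat.le_ceil Rσ
  have hk_lt : k < n := by omega
  have h2k_lt : 2 * k < n := by omega
  refine ⟨UT.ofSite _ fun _ => ⟨0, by omega⟩, UT.ofSite _ fun _ => ⟨k, hk_lt⟩, UT.ofSite _ fun _ => ⟨2 * k, h2k_lt⟩,
    ?_, ?_, ?_⟩
  · have h := tdist1_fin1_of_le n ⟨0, by omega⟩ ⟨k, hk_lt⟩ (by simp) (by simp; omega)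
    rw [h]; simpa using hkR
  · have h := tdist1_fin1_of_le n ⟨k, hk_lt⟩ ⟨2 * k, h2k_lt⟩ (by simp; omega) (by simp; omega)
    rw [tdist1_comm, h]
    have e : 2 * k - k = k := by omega
    simpa [e] using hkR
  · have h01 := tdist1_fin1_of_le n ⟨0, by omega⟩ ⟨k, hk_lt⟩ (by simp) (by simp; omega)
    have h12 := tdist1_fin1_of_le n ⟨k, hk_lt⟩ ⟨2 * k, h2k_lt⟩ (by simp; omega) (by simp; omega)
    have h02 := tdist1_fin1_of_le n ⟨0, by omega⟩ ⟨2 * k, h2k_lt⟩ (by simp) (by simp; omega)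
    rw [h01, h12, h02]
    have e1 : 2 * k - k = k := by omega
    simp only [Nat.sub_zero, e1]
    push_cast
    linarith

/-- ★ **THE CLOSED INSTANCE ON CIRCLES**: for every `d_m ≥ 1`, `κ₁ ≥ 0`, `M > 0`, `α ≥ 0`, the package `rf = nodeAPackage d_m κ₁ M α`
meets the reference-rung block (as in `entrywiseBlockRung_joint_nonvacuous`) and, on EVERY circle `ℤ∕nℤ` with `n ≥ 4⌈rf.R_σ⌉`, some
`d₁`-collinear triple with gaps `≥ rf.R_σ` carries the NODE-A block at `rf` (core conjuncts; `hKP` in (B)'s closed form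
`kbarModel 1 κ₁ BΔ ≤ rf.KbarP`) — so both blocks are inhabited TOGETHER by actual data.
[cite: Balaban1988RG2Cluster, (1.11) p.5, (2.5)–(2.7) pp.12–13, p.15, (2.16) p.16; Balaban1984PropagatorsII, (2.46) p.231] -/
theorem entrywiseBlockRung_joint_nonvacuous_circle (dm : ℕ) (hdm : 1 ≤ dm) {κ₁ M α : ℝ} (hκ₁ : 0 ≤ κ₁) (hM : 0 < M)
    (hα : 0 ≤ α) (cube : TPt d N') (n : ℕ) [NeZero n] (hn : 4 * ⌈(nodeAPackage dm κ₁ M α).Rσ⌉₊ ≤ n) :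
    ∃ (rf : RefPackage) (R₁ : ℝ) (x₀ z x₁ : UT (fun _ : Fin 1 => n)), rf = nodeAPackage dm κ₁ M α ∧ R₁ = α + 1 ∧
      rf.Admissible ∧ 0 < R₁ ∧ R₁ < rf.R ∧
      8 * rf.KbarP * rf.cV₀ * Real.exp (-(rf.εP * rf.Rσ)) ≤ rf.m₀ ∧ 8 * rf.KbarP * rf.cV₀ * R₁ ≤ rf.m₀ * rf.R ∧
      8 * rf.KbarA * rf.cV * Real.exp (-(rf.εA * rf.Rσ)) ≤ rf.mA₀ ∧ 8 * rf.KbarA * rf.cV * R₁ ≤ rf.mA₀ * rf.R ∧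
      (rf.toWalkPackage R₁).PositiveRates ∧ rf.η ≤ (rf.toWalkPackage R₁).etaMax ∧ α < R₁ ∧
      (1 : ℕ) ≤ rf.dm ∧
      ∃ (Δ₀ : ℂ → Matrix (Unit ⊕ Unit) (Unit ⊕ Unit) ℂ) (BΔ M₁ : ℝ)
        (J : (Unit ⊕ Unit) × (Unit ⊕ Unit) → Finset (TPt d N'))
        (KK : (TPt d N' → ℂ) → ℂ → Matrix (Unit ⊕ Unit) (Unit ⊕ Unit) ℂ),
        RawEntryLetters Δ₀ (loc2 x₀ x₁) rf.R 7 BΔ ∧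
        GeodesicDecoration J (loc2 x₀ x₁) ({z} : Finset (UT (fun _ : Fin 1 => n))) 1 M₁ ∧ 2 * κ₁ ≤ 1 * M₁ ∧
        kbarModel 1 κ₁ BΔ ≤ rf.KbarP ∧
        (∀ σ u, KK σ u =
          (((1 : Matrix (Unit ⊕ Unit) (Unit ⊕ Unit) ℝ).map (algebraMap ℝ ℂ))ᵀ *
            sDecorate (fun ω : ((Unit ⊕ Unit) × (Unit ⊕ Unit)) ⊕ ((Unit ⊕ Unit) × (Unit ⊕ Unit)) =>
                J (Sum.elim id id ω))
              (fun ω u => Sum.elim (fun ω => (1 / 2 : ℂ) • rawEntryTerm Δ₀ ω u)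
                (fun ω => (1 / 2 : ℂ) • (rawEntryTerm Δ₀ ω u)ᵀ) ω) σ u *
            (1 : Matrix (Unit ⊕ Unit) (Unit ⊕ Unit) ℝ).map (algebraMap ℝ ℂ))) ∧
        (∀ v : Unit ⊕ Unit → ℂ, rf.m₀ * ∑ i, ‖v i‖ ^ 2 ≤ (∑ i, star (v i) * (KK 0 0 *ᵥ v) i).re) ∧
        (∀ k, ∀ z' ∈ ({z} : Finset (UT (fun _ : Fin 1 => n))), rf.Rσ ≤ tdist1 (fun _ : Fin 1 => n) (loc2 x₀ x₁ k) z') ∧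
        (∀ x, (Finset.univ.filter fun k => loc2 x₀ x₁ k = x).card ≤ rf.nB) ∧
        (∃ ω, (J ω).Nonempty) ∧
        (∀ σ u, KK σ u (Sum.inl ()) (Sum.inr ()) =
          σ cube * (((Real.exp (-(7 * tdist1 (fun _ : Fin 1 => n) x₀ x₁)) / rf.R : ℝ) : ℂ) * u / 2)) := by
  obtain ⟨hR, -, -, -, hεP, hκP, hKP, hm₀, -, -, -, -, hη, hRσ, hnB, hdm'⟩ := nodeAPackage_fields dm κ₁ M α
  have hT := tNodeA_pos (dm := dm) (κ₁ := κ₁) hM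
  have hth := thresholds_nodeAPackage (dm := dm) (κ₁ := κ₁) hM hα
  have hrf := admissible_nodeAPackage (dm := dm) (κ₁ := κ₁) hM hα
  have hRσpos : 0 < (nodeAPackage dm κ₁ M α).Rσ := by rw [hRσ]; exact hT
  obtain ⟨x₀, z, x₁, h0, h1, hcol⟩ := exists_collinear_triple_circle hRσpos n hn
  have hRpos : 0 < (nodeAPackage dm κ₁ M α).R := hrf.hR
  have hne : x₀ ≠ x₁ := ne_of_collinear hRσpos h0 hcol
  refine ⟨nodeAPackage dm κ₁ M α, α + 1, x₀, z, x₁, rfl, rfl, hrf, by linarith, ?_, hth.1, hth.2.1, hth.2.2.1, hth.2.2.2,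
    positiveRates_nodeAPackage (α + 1), ?_, by linarith, by rw [hdm']; exact hdm,
    fluctR M (nodeAPackage dm κ₁ M α).R (Real.exp (-(7 * tdist1 _ x₀ x₁))), M + 1, 2 * κ₁ + 1, deco x₀ x₁ z cube,
    condOpR x₀ x₁ z cube M (nodeAPackage dm κ₁ M α).R (Real.exp (-(7 * tdist1 _ x₀ x₁))),
    rawEntryLetters_fluctR hM.le hRpos x₀ x₁, geodesicDecoration_deco cube x₀ x₁ z (by linarith), by nlinarith, ?_,
    fun σ u => condOpR_eq cube x₀ x₁ z M _ _ σ u, ?_, ?_, ?_, ⟨(Sum.inl (), Sum.inr ()), ?_⟩,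
    fun σ u => condOpR_inl_inr cube hcol σ u () ()⟩
  · rw [hR]; nlinarith
  · rw [etaMax_nodeAPackage_indep, hη]
  · rw [hKP]
    exact kbarModel_le_kbarNodeA (ν := 1) (κ₁ := κ₁) hM.le hdm
  · intro v; rw [hm₀]; exact condOpR_accretive cube hRσpos h0 h1 hcol v
  · intro k; exact far_loc2 h0 h1 k
  · intro x; rw [hnB]; exact fiber_loc2_le_one hne x
  · rw [deco_inl_inr cube hcol]; exact Finset.singleton_nonempty _

end Circle

end Literature.MathematicalPhysics.QuantumFieldTheory.Balaban1983to89.B13EntrywiseBlockRungWitness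

end
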